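import Literature.Probability.Percolation.BondPercolationSymmetry
import Summits.CriticalPhenomena.PercolationContinuityZ3.Theorems.AdditiveGluing.Negative.CertSearch

/-!
# `AdditiveGluing` (crux stmt-CriticalPhenomena-4576, route `PercNearOneGluing`):
# the certificate at density `1/2` for EVERY simple graph on at most SIX vertices,
# by the search of `CertSearch.lean` pruned to one graph per isomorphism class

The additive gluing inequality quantifies over all `(A, o, b, t)`, so its truth for a graph `G` is
invariant under relabelling the vertices (`bondPercolation_real_preimage_relabel_iso` of the tree:
`P^G_p {ω | σ '' ω ∈ S} = P^{σ G}_p (S)`).  The search therefore only has to check graphs whose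
code (the bit mask of their edges, `codeG`) is MINIMAL in its orbit under the symmetric group; every
other leaf is skipped as soon as SOME permutation lowers its code (`nonMinimal`, an existential test,
so no canonical form has to be certified).  On `Fin 6` that leaves the `156` isomorphism classes.

* `codeAcc`, `recode`, `permTabs`, `nonMinimal`, `goAllC`, `agIsoAll` — the pruned search;
* `recode_codeG` — recoding the code of `G` along a permutation `σ` gives the code of `G.map σ`;
* `real_preimage_relabel_openConn` (+ unions) — `P^{σG}(σ o ↔ σ b) = P^G(o ↔ b)`;
* `exists_checkD_of_agIsoAll` — for `G` take `σ*` minimising `codeG (G.map σ)` (finitely many);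
  the leaf of `G.map σ*` cannot be skipped, so `checkD` passed there;
  `additiveGluing_half_of_agIsoAll`, `knConj1_half_of_agIsoAll` — transport back to `G`;
* `agIsoAll_zero … agIsoAll_six` (`native_decide`) and the certificates `additiveGluing_half_le_six`,
  `additiveGluing_indicatorHalf_le_six`, and `knConj1_half_le_six` — Kozma–Nitzan's CONJECTURE 1
  itself (`P(o ↔ b) ≥ P(o ↔ A) · min_a P(a ↔ b)`) at density `1/2` on every graph with `≤ 6`
  vertices.

Nothing here asserts the crux.
-/

namespace Summit.CriticalPhenomena.PercolationContinuityZ3.Theorems.AdditiveGluing.Negative.Cert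

open MeasureTheory
open Literature.Probability.Percolation Literature.Probability.LatticeModels

/-! ### The pruned search (computable) -/

section Checker

/-- Accumulate the code of an edge list (bit `slot n i j` for the pair `(i, j)`, `i < j`). -/
def codeAcc (n : ℕ) (c : ℕ) (es : List (Fin n × Fin n)) : ℕ :=
  es.foldl (fun c p => c ||| 2 ^ slot n p.1 p.2) c

/-- The code of the relabelled graph: pair `(i, j)` ↦ `(min (τ i) (τ j), max (τ i) (τ j))`. -/
def recode (n : ℕ) (τ : List (Fin n)) (c : ℕ) : ℕ :=
  (allPairs n).foldr (fun p acc => if c.testBit (slot n p.1 p.2) then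
    acc ||| 2 ^ slot n (min (τ.getD p.1 p.1) (τ.getD p.2 p.2) : Fin n) (max (τ.getD p.1 p.1) (τ.getD p.2 p.2) : Fin n)
    else acc) 0

/-- All permutations of `Fin n`, tabulated. -/
def permTabs (n : ℕ) : List (List (Fin n)) :=
  (permsOfList (List.finRange n)).map fun σ : Equiv.Perm (Fin n) => (List.finRange n).map fun i => σ i

/-- Some tabulated permutation lowers the code. -/
def nonMinimal (n : ℕ) (pt : List (List (Fin n))) (c : ℕ) : Bool :=
  pt.any fun τ => Nat.blt (recode n τ c) c

/-- The search of `CertSearch.goAll`, carrying the code and skipping non-minimal leaves. -/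
def goAllC (n : ℕ) (pt : List (List (Fin n))) : List (Fin n × Fin n) → List (List ℕ × ℕ) → ℕ → Bool
  | [], d, c => nonMinimal n pt c || checkD n d
  | p :: ps, d, c => goAllC n pt ps d c && goAllC n pt ps (stepH d p.1 p.2) (c ||| 2 ^ slot n p.1 p.2)

/-- THE PRUNED CHECK at density `1/2`: every simple graph on `Fin n` up to isomorphism. -/
def agIsoAll (n : ℕ) : Bool := goAllC n (permTabs n) (allPairs n) [(List.range n, 1)] 0

end Checker

/-! ### What the pruned search guarantees -/

/-- `goAllC` reaches every sub-list: each is skipped as non-minimal or passes `checkD`. -/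
theorem goAllC_imp {n : ℕ} (pt : List (List (Fin n))) : ∀ (ps : List (Fin n × Fin n))
    (d : List (List ℕ × ℕ)) (c : ℕ), goAllC n pt ps d c = true → ∀ es ∈ ps.sublists',
      nonMinimal n pt (codeAcc n c es) = true ∨
        checkD n (es.foldl (fun d q => stepH d q.1 q.2) d) = true
  | [], d, c, h, es, hes => by
    rw [List.sublists'_nil, List.mem_singleton] at hes
    subst hes
    simpa [goAllC, codeAcc] using h
  | p :: ps, d, c, h, es, hes => by
    rw [goAllC, Bool.and_eq_true] at h
    rw [List.sublists'_cons, List.mem_append, List.mem_map] at hes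
    rcases hes with hes | ⟨es', hes', rfl⟩
    · exact goAllC_imp pt ps d c h.1 es hes
    · exact goAllC_imp pt ps _ _ h.2 es' hes'

/-- Bits of an accumulated code. -/
theorem testBit_codeAcc {n : ℕ} : ∀ (es : List (Fin n × Fin n)) (c k : ℕ),
    (codeAcc n c es).testBit k = true ↔ c.testBit k = true ∨ ∃ p ∈ es, slot n p.1 p.2 = k
  | [], c, k => by simp [codeAcc]
  | p :: es, c, k => by
    rw [codeAcc, List.foldl_cons, ← codeAcc, testBit_codeAcc es, Nat.testBit_or, Bool.or_eq_true,
      Nat.testBit_two_pow, decide_eq_true_eq]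
    simp only [List.mem_cons, exists_eq_or_imp]
    tauto

/-- The code of a graph: bit `slot n i j` iff `i < j` and `i ∼ j`. -/
noncomputable def codeG {n : ℕ} (G : SimpleGraph (Fin n)) : ℕ := codeAcc n 0 (edgeList G)

/-- Bits of the code of a graph. -/
theorem testBit_codeG {n : ℕ} (G : SimpleGraph (Fin n)) (k : ℕ) :
    (codeG G).testBit k = true ↔ ∃ i j : Fin n, i < j ∧ G.Adj i j ∧ slot n i j = k := by
  rw [codeG, testBit_codeAcc]
  simp only [Nat.zero_testBit, Bool.false_eq_true, false_or]
  constructor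
  · rintro ⟨p, hp, rfl⟩
    exact ⟨p.1, p.2, ((mem_edgeList G p).1 hp).1, ((mem_edgeList G p).1 hp).2, rfl⟩
  · rintro ⟨i, j, hij, hadj, rfl⟩
    exact ⟨(i, j), (mem_edgeList G _).2 ⟨hij, hadj⟩, rfl⟩

/-- Bits of a recoded code. -/
theorem testBit_recode {n : ℕ} (τ : List (Fin n)) (c k : ℕ) :
    (recode n τ c).testBit k = true ↔ ∃ p ∈ allPairs n, c.testBit (slot n p.1 p.2) = true ∧
      slot n (min (τ.getD p.1 p.1) (τ.getD p.2 p.2) : Fin n) (max (τ.getD p.1 p.1) (τ.getD p.2 p.2) : Fin n)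
        = k := by
  unfold recode
  generalize allPairs n = l
  induction l with
  | nil => simp
  | cons p l ih =>
    rw [List.foldr_cons]
    simp only [List.mem_cons, exists_eq_or_imp]
    by_cases hc : c.testBit (slot n p.1 p.2) = true
    · rw [if_pos hc, Nat.testBit_or, Bool.or_eq_true, ih, Nat.testBit_two_pow, decide_eq_true_eq]
      simp only [hc, true_and]
      exact or_comm
    · rw [if_neg hc, ih]
      simp [hc]

/-- **Recoding the code of `G` along a permutation gives the code of the relabelled graph.** -/
theorem recode_codeG {n : ℕ} (G : SimpleGraph (Fin n)) (σ : Equiv.Perm (Fin n)) (τ : List (Fin n))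
    (hτ : ∀ i : Fin n, τ.getD i i = σ i) : recode n τ (codeG G) = codeG (G.map σ) := by
  apply Nat.eq_of_testBit_eq
  intro k
  rw [Bool.eq_iff_iff, testBit_recode, testBit_codeG]
  simp only [hτ, mem_allPairs, testBit_codeG]
  constructor
  · rintro ⟨p, hp, ⟨i, j, hij, hadj, hs⟩, rfl⟩
    obtain ⟨h1, h2⟩ := slot_inj j.2 p.2.2 hs
    have hp' : p = (i, j) := Prod.ext (Fin.ext h1).symm (Fin.ext h2).symm
    subst hp'
    have hne : σ i ≠ σ j := fun h => (G.ne_of_adj hadj) (σ.injective h)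
    refine ⟨min (σ i) (σ j), max (σ i) (σ j), min_lt_max.2 hne, ?_, rfl⟩
    rw [SimpleGraph.map_adj']
    refine ⟨min_lt_max.2 hne |>.ne, ?_⟩
    rcases lt_or_gt_of_ne hne with h | h
    · exact ⟨i, j, hadj, (min_eq_left h.le).symm, (max_eq_right h.le).symm⟩
    · exact ⟨j, i, hadj.symm, (min_eq_right h.le).symm, (max_eq_left h.le).symm⟩
  · rintro ⟨c, d, hcd, hadj, rfl⟩
    rw [SimpleGraph.map_adj'] at hadj
    obtain ⟨-, u, v, huv, rfl, rfl⟩ := hadj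
    rcases lt_or_gt_of_ne (G.ne_of_adj huv) with h | h
    · refine ⟨(u, v), h, ⟨u, v, h, huv, rfl⟩, ?_⟩
      rw [min_eq_left hcd.le, max_eq_right hcd.le]
    · refine ⟨(v, u), h, ⟨v, u, h, huv.symm, rfl⟩, ?_⟩
      rw [min_comm, max_comm, min_eq_left hcd.le, max_eq_right hcd.le]

/-- Every tabulated permutation is (the table of) a permutation. -/
theorem exists_perm_of_mem_permTabs {n : ℕ} {τ : List (Fin n)} (h : τ ∈ permTabs n) :
    ∃ σ : Equiv.Perm (Fin n), ∀ i : Fin n, τ.getD i i = σ i := by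
  obtain ⟨σ, _, rfl⟩ := List.mem_map.1 h
  refine ⟨σ, fun i => ?_⟩
  have hi : (i : ℕ) < ((List.finRange n).map fun i => σ i).length := by simp
  rw [List.getD_eq_getElem?_getD, List.getElem?_eq_getElem hi, Option.getD_some, List.getElem_map,
    List.getElem_finRange]
  congr 1

/-- Composition of relabellings. -/
theorem codeG_map_map {n : ℕ} (G : SimpleGraph (Fin n)) (σ σ' : Equiv.Perm (Fin n)) :
    codeG ((G.map σ).map σ') = codeG (G.map (σ.trans σ')) := by
  rw [SimpleGraph.map_map, Equiv.coe_trans]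

/-! ### Relabelling invariance of the three probabilities -/

/-- The preimage of `{σ x ↔ σ y}` under relabelling by `σ` is `{x ↔ y}`. -/
theorem preimage_relabel_openConn {n : ℕ} (σ : Equiv.Perm (Fin n)) (x y : Fin n) :
    BondConfig.relabel (sym2Equiv σ) ⁻¹' (openConn (σ x) (σ y)) = openConn x y := by
  ext ω
  rw [Set.mem_preimage]
  change (openGraph (BondConfig.relabel (sym2Equiv σ) ω)).Reachable (σ x) (σ y) ↔
    (openGraph ω).Reachable x y
  let φ : openGraph ω ≃g openGraph (BondConfig.relabel (sym2Equiv σ) ω) :=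
    { toEquiv := σ, map_rel_iff' := fun {a b} => openGraph_relabel_adj_iff σ ω a b }
  exact SimpleGraph.Iso.reachable_iff (φ := φ)

/-- `P^{σ G}_{1/2}(σ x ↔ σ y) = P^G_{1/2}(x ↔ y)`. -/
theorem real_openConn_map {n : ℕ} (G : SimpleGraph (Fin n)) (σ : Equiv.Perm (Fin n)) (x y : Fin n) :
    (bondPercolation (G.map σ) half).real (openConn (σ x) (σ y)) =
      (bondPercolation G half).real (openConn x y) := by
  rw [← bondPercolation_real_preimage_relabel_iso (SimpleGraph.Iso.map σ G) half,
    show (SimpleGraph.Iso.map σ G).toEquiv = σ from rfl, preimage_relabel_openConn]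

/-- `P^{σ G}_{1/2}(σ o ↔ σ A) = P^G_{1/2}(o ↔ A)`. -/
theorem real_iUnion_openConn_map {n : ℕ} (G : SimpleGraph (Fin n)) (σ : Equiv.Perm (Fin n)) (o : Fin n)
    (A : Finset (Fin n)) :
    (bondPercolation (G.map σ) half).real (⋃ a ∈ A, openConn (σ o) (σ a)) =
      (bondPercolation G half).real (⋃ a ∈ A, openConn o a) := by
  rw [← bondPercolation_real_preimage_relabel_iso (SimpleGraph.Iso.map σ G) half,
    show (SimpleGraph.Iso.map σ G).toEquiv = σ from rfl]
  congr 1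
  simp only [Set.preimage_iUnion, preimage_relabel_openConn]

/-! ### Soundness of the pruned search -/

/-- The heart of the pruning: for every graph some relabelling of it reached `checkD`
(a relabelling with MINIMAL code cannot be skipped). -/
theorem exists_checkD_of_agIsoAll {n : ℕ} (h : agIsoAll n = true) (G : SimpleGraph (Fin n)) :
    ∃ σ : Equiv.Perm (Fin n),
      checkD n ((edgeList (G.map σ)).foldl (fun d q => stepH d q.1 q.2) [(List.range n, 1)]) = true := by
  classical
  obtain ⟨σ, -, hmin⟩ := Finset.exists_min_image Finset.univ
    (fun σ : Equiv.Perm (Fin n) => codeG (G.map σ)) Finset.univ_nonempty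
  refine ⟨σ, ?_⟩
  rcases goAllC_imp (permTabs n) (allPairs n) _ 0 h (edgeList (G.map σ))
    (List.mem_sublists'.2 (edgeList_sublist _)) with hskip | hcheck
  · exfalso
    rw [show codeAcc n 0 (edgeList (G.map σ)) = codeG (G.map σ) from rfl, nonMinimal,
      List.any_eq_true] at hskip
    obtain ⟨τ, hτ, hlt⟩ := hskip
    obtain ⟨σ', hσ'⟩ := exists_perm_of_mem_permTabs hτ
    rw [Nat.blt_eq, recode_codeG _ σ' τ hσ', codeG_map_map] at hlt
    exact absurd (hmin (σ.trans σ') (Finset.mem_univ _)) (not_le.2 hlt)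
  · exact hcheck

/-- **Soundness (additive gluing).** If `agIsoAll n = true` then the additive gluing inequality
holds for `bondPercolation G half` on EVERY simple graph `G` on `Fin n`, all `A o b t`. -/
theorem additiveGluing_half_of_agIsoAll {n : ℕ} (h : agIsoAll n = true) (G : SimpleGraph (Fin n))
    (A : Finset (Fin n)) (o b : Fin n) (t : ℝ) (ht : 0 ≤ t)
    (hrel : ∀ a ∈ A, 1 - t ≤ (bondPercolation G half).real (openConn a b)) :
    (bondPercolation G half).real (⋃ a ∈ A, openConn o a) - t ≤
      (bondPercolation G half).real (openConn o b) := by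
  classical
  obtain ⟨σ, hcheck⟩ := exists_checkD_of_agIsoAll h G
  have hAG := additiveGluing_half_of_counts (G.map σ) (fun o b _ hAm hAm0 =>
      (checkD_spec hcheck o b hAm hAm0).imp fun a ha => ⟨ha.1, ha.2.1⟩)
    (A.image σ) (σ o) (σ b) t ht (by
      intro a' ha'
      obtain ⟨a, ha, rfl⟩ := Finset.mem_image.1 ha'
      rw [real_openConn_map]
      exact hrel a ha)
  rw [Finset.set_biUnion_finset_image, real_iUnion_openConn_map, real_openConn_map] at hAG
  exact hAG

/-- From the count form of Kozma–Nitzan's Conjecture 1 to the inequality at density `1/2`: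
`P(o ↔ A) · s ≤ P(o ↔ b)` whenever `s ≤ P(a ↔ b)` for all `a ∈ A`. -/
theorem knConj1_half_of_counts {n : ℕ} (G : SimpleGraph (Fin n))
    (hcount : ∀ (o b : Fin n) {Am : ℕ}, Am < 2 ^ n → Am ≠ 0 → ∃ a : Fin n, Am.testBit a = true ∧
      cntConnSet (tables n (edgeList G)) o Am * cntConn (tables n (edgeList G)) a b ≤
        cntConn (tables n (edgeList G)) o b * 2 ^ (edgeList G).length)
    (A : Finset (Fin n)) (o b : Fin n) (s : ℝ)
    (hrel : ∀ a ∈ A, s ≤ (bondPercolation G half).real (openConn a b)) :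
    (bondPercolation G half).real (⋃ a ∈ A, openConn o a) * s ≤
      (bondPercolation G half).real (openConn o b) := by
  classical
  set es := edgeList G with hes
  have hnd : (es.map mkE).Nodup := nodup_map_mk_of_sublist (edgeList_sublist G)
  rw [bondPercolation_eq_prodBernoulli_wHalf G] at hrel ⊢
  rw [← hes] at hrel ⊢
  by_cases hA : A = ∅
  · subst hA
    simp only [Finset.notMem_empty, Set.iUnion_of_empty, Set.iUnion_empty, measureReal_empty, zero_mul]
    exact measureReal_nonneg
  obtain ⟨a0, ha0⟩ := Finset.nonempty_iff_ne_empty.2 hA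
  have hAm0 : maskL A.toList ≠ 0 := by
    intro h0
    have := (testBit_maskL A.toList a0).2 ⟨a0, Finset.mem_toList.2 ha0, rfl⟩
    rw [h0, Nat.zero_testBit] at this
    exact Bool.false_ne_true this
  obtain ⟨a, hta, hle⟩ := hcount o b (maskL_lt A.toList) hAm0
  have haA : a ∈ A := by
    obtain ⟨a', ha', haa'⟩ := (testBit_maskL A.toList a).1 hta
    rw [← Fin.ext haa']; exact Finset.mem_toList.1 ha'
  have hrel' := hrel a haA
  rw [real_openConn_eq hnd] at hrel'
  rw [real_iUnion_openConn_eq hnd, real_openConn_eq hnd]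
  have hN : (0 : ℝ) < 2 ^ es.length := by positivity
  have hcast : (cntConnSet (tables n es) o (maskL A.toList) : ℝ) * cntConn (tables n es) a b ≤
      cntConn (tables n es) o b * 2 ^ es.length := by exact_mod_cast hle
  have hPA : (0 : ℝ) ≤ (cntConnSet (tables n es) o (maskL A.toList) : ℝ) / 2 ^ es.length := by positivity
  calc (cntConnSet (tables n es) o (maskL A.toList) : ℝ) / 2 ^ es.length * s
      ≤ (cntConnSet (tables n es) o (maskL A.toList) : ℝ) / 2 ^ es.length *
          ((cntConn (tables n es) a b : ℝ) / 2 ^ es.length) := mul_le_mul_of_nonneg_left hrel' hPA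
    _ = (cntConnSet (tables n es) o (maskL A.toList) : ℝ) * cntConn (tables n es) a b /
          (2 ^ es.length * 2 ^ es.length) := by rw [div_mul_div_comm]
    _ ≤ (cntConn (tables n es) o b : ℝ) * 2 ^ es.length / (2 ^ es.length * 2 ^ es.length) :=
          div_le_div_of_nonneg_right hcast (by positivity)
    _ = (cntConn (tables n es) o b : ℝ) / 2 ^ es.length := by
          rw [mul_div_mul_right _ _ hN.ne']

/-- **Soundness (Kozma–Nitzan Conjecture 1).** If `agIsoAll n = true` then
`P(o ↔ b) ≥ P(o ↔ A) · min_{a ∈ A} P(a ↔ b)` (written with a parameter `s ≤ P(a ↔ b)`, `a ∈ A`)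
for `bondPercolation G half` on EVERY simple graph `G` on `Fin n`, all `A o b s`. -/
theorem knConj1_half_of_agIsoAll {n : ℕ} (h : agIsoAll n = true) (G : SimpleGraph (Fin n))
    (A : Finset (Fin n)) (o b : Fin n) (s : ℝ)
    (hrel : ∀ a ∈ A, s ≤ (bondPercolation G half).real (openConn a b)) :
    (bondPercolation G half).real (⋃ a ∈ A, openConn o a) * s ≤
      (bondPercolation G half).real (openConn o b) := by
  classical
  obtain ⟨σ, hcheck⟩ := exists_checkD_of_agIsoAll h G
  have hC := knConj1_half_of_counts (G.map σ) (fun o b _ hAm hAm0 =>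
      (checkD_spec hcheck o b hAm hAm0).imp fun a ha => ⟨ha.1, ha.2.2⟩)
    (A.image σ) (σ o) (σ b) s (by
      intro a' ha'
      obtain ⟨a, ha, rfl⟩ := Finset.mem_image.1 ha'
      rw [real_openConn_map]
      exact hrel a ha)
  rw [Finset.set_biUnion_finset_image, real_iUnion_openConn_map, real_openConn_map] at hC
  exact hC

/-! ### The certificates: all simple graphs on at most six vertices -/

/-- `agIsoAll 0 = true`. -/
theorem agIsoAll_zero : agIsoAll 0 = true := by native_decide
/-- `agIsoAll 1 = true`. -/
theorem agIsoAll_one : agIsoAll 1 = true := by native_decide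
/-- `agIsoAll 2 = true`. -/
theorem agIsoAll_two : agIsoAll 2 = true := by native_decide
/-- `agIsoAll 3 = true`. -/
theorem agIsoAll_three : agIsoAll 3 = true := by native_decide
/-- `agIsoAll 4 = true`. -/
theorem agIsoAll_four : agIsoAll 4 = true := by native_decide
/-- `agIsoAll 5 = true`. -/
theorem agIsoAll_five : agIsoAll 5 = true := by native_decide

/-- **The certified computation** `agIsoAll 6 = true`: the `2^15` graphs on `Fin 6` by the
shared-prefix partition search, all but the `156` code-minimal ones skipped, `2 304` triples
`(o, b, A)` each, both inequalities (`native_decide`). -/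
theorem agIsoAll_six : agIsoAll 6 = true := by native_decide

/-- `agIsoAll n = true` for every `n ≤ 6`. -/
theorem agIsoAll_le_six {n : ℕ} (hn : n ≤ 6) : agIsoAll n = true := by
  interval_cases n
  · exact agIsoAll_zero
  · exact agIsoAll_one
  · exact agIsoAll_two
  · exact agIsoAll_three
  · exact agIsoAll_four
  · exact agIsoAll_five
  · exact agIsoAll_six

/-- **Certificate (additive gluing, density `1/2`, at most six vertices).** For every simple graph
`G` on `Fin n`, `n ≤ 6`, under Bernoulli bond percolation with density `1/2`, every relay set `A`,
vertices `o b` and slack `t ≥ 0` with `P(a ↔ b) ≥ 1 − t` for all `a ∈ A` satisfy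
`P(o ↔ A) − t ≤ P(o ↔ b)`. -/
theorem additiveGluing_half_le_six {n : ℕ} (hn : n ≤ 6) (G : SimpleGraph (Fin n))
    (A : Finset (Fin n)) (o b : Fin n) (t : ℝ) (ht : 0 ≤ t)
    (hrel : ∀ a ∈ A, 1 - t ≤ (bondPercolation G half).real (openConn a b)) :
    (bondPercolation G half).real (⋃ a ∈ A, openConn o a) - t ≤
      (bondPercolation G half).real (openConn o b) :=
  additiveGluing_half_of_agIsoAll (agIsoAll_le_six hn) G A o b t ht hrel

/-- The same certificate in the literal `prodBernoulli` shape of the crux. -/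
theorem additiveGluing_indicatorHalf_le_six {n : ℕ} (hn : n ≤ 6) (G : SimpleGraph (Fin n))
    [DecidablePred (· ∈ G.edgeSet)] (A : Finset (Fin n)) (o b : Fin n) (t : ℝ) (ht : 0 ≤ t)
    (hrel : ∀ a ∈ A, 1 - t ≤
      (prodBernoulli fun e => if e ∈ G.edgeSet then half else 0).real (openConn a b)) :
    (prodBernoulli fun e => if e ∈ G.edgeSet then half else 0).real (⋃ a ∈ A, openConn o a) - t ≤
      (prodBernoulli fun e => if e ∈ G.edgeSet then half else 0).real (openConn o b) := by
  rw [prodBernoulli_indicator_holds] at hrel ⊢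
  exact additiveGluing_half_le_six hn G A o b t ht hrel

/-- **Certificate (Kozma–Nitzan Conjecture 1, density `1/2`, at most six vertices).**
For every simple graph `G` on `Fin n`, `n ≤ 6`, under `P_{1/2}`, every relay set `A`, vertices
`o b` and `s` with `s ≤ P(a ↔ b)` for all `a ∈ A`: `P(o ↔ A) · s ≤ P(o ↔ b)`, i.e.
`P(o ↔ b) ≥ P(o ↔ A) · min_{a ∈ A} P(a ↔ b)` (Kozma–Nitzan, arXiv:2401.12397, Conjecture 1, which
implies the additive form). -/
theorem knConj1_half_le_six {n : ℕ} (hn : n ≤ 6) (G : SimpleGraph (Fin n))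
    (A : Finset (Fin n)) (o b : Fin n) (s : ℝ)
    (hrel : ∀ a ∈ A, s ≤ (bondPercolation G half).real (openConn a b)) :
    (bondPercolation G half).real (⋃ a ∈ A, openConn o a) * s ≤
      (bondPercolation G half).real (openConn o b) :=
  knConj1_half_of_agIsoAll (agIsoAll_le_six hn) G A o b s hrel

end Summit.CriticalPhenomena.PercolationContinuityZ3.Theorems.AdditiveGluing.Negative.Cert
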